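import Summits.CriticalPhenomena.SAWScalingLimit.Theorems.SAWLatticeVirasoroHexSimpleSubseqLimitsReduction
import Summits.CriticalPhenomena.SAWScalingLimit.Theorems.SAWLoopFugacityFlowSimpleSubseqLimitsBoundaryCore
import HarnessLib

/-!
# Item `HexSimpleSubseqLimits` (stmt-CriticalPhenomena-7148): necessity of the no-boundary-crawling
bound, and the exact equivalence modulo tightness

Sequel of `SAWLatticeVirasoroHexSimpleSubseqLimitsReduction` (which proves the closed half of the
item unconditionally and derives the item from two lattice estimates: (i) the uniform injectivity
modulus and (ii) the no-boundary-crawling bound of the critical hexagonal SAW).  PROVED here: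

* `eventually_le_of_null_closedApprox` — an abstract "portmanteau by contradiction" for the
  hexagonal SAW laws: under tightness along the mesh, if a decreasing sequence of CLOSED events
  `C m` shrinks to a set that every probability subsequential limit law annihilates, and lattice
  events `W j` satisfy `{curve ∈ W j} ⊆ {curve ∈ C m}` for `m ≤ j`, then for every `θ > 0` some
  `W j` has `hexSAWLaw`-mass eventually `≤ θ` (Prokhorov along the mesh + the closed-set half of the
  portmanteau theorem);
* `iInter_closure_nearFrontierVisit_subset` — a class lying in the closure of every
  near-boundary-visit event `{∃ x ∈ trace, infDist x ∂D < 1/(n+1), ρ < dist x a, ρ < dist x b}`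
  has a trace point ON `∂D` at distance `≥ ρ` from both marked points (the lattice-free core
  `SimpleSubseqLimits.Boundary.Core.stub_boundaryCore` of the `δℤ²` twin, transported to the
  trace-phrased events);
* `boundaryDecay_of_hexTight_of_hexSimpleSubseqLimits` — given tightness along the mesh
  (`HexTight`-shape hypothesis), `HexSimpleSubseqLimits` IMPLIES the no-boundary-crawling bound (ii);
* `hexSimpleSubseqLimits_iff_of_hexTight` — hence, given tightness, the item is EQUIVALENT to the
  conjunction of the two lattice estimates (i) ∧ (ii) of
  `hexSimpleSubseqLimits_of_uniformModulus_of_boundaryDecay`.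

So the open content of stmt-CriticalPhenomena-7148 is pinned exactly: modulo tightness of the
critical hexagonal SAW curves it is the pair of mesh-uniform estimates "no macroscopic
near-retracing" (i) and "no boundary crawling off the marked points" (ii), neither of which is in
print at `x = x_c`.
-/

noncomputable section

open scoped Topology NNReal ENNReal BoundedContinuousFunction
open Filter Set MeasureTheory Metric
open Literature.Probability.LatticeModels (HexVertex hexGraph hexCenter)
open Literature.Probability.RandomPlanarGeometry
open Literature.Probability.RandomPlanarGeometry.SAW
open Summit.CriticalPhenomena.SAWScalingLimit.Theses.SAWLatticeVirasoro (HexSimpleSubseqLimits)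
open Summit.CriticalPhenomena.SAWScalingLimit.Theorems.ObservableToSLE.Negative
  (eventually_isProbabilityMeasure_hexSAWLaw)
open Summit.CriticalPhenomena.SAWScalingLimit.Theorems.SimpleSubseqLimits.Boundary.Core
  (stub_boundaryCore)

namespace Summit.CriticalPhenomena.SAWScalingLimit.Theorems.HexSimpleSubseqLimits

/-! ### Portmanteau by contradiction along the mesh -/

/-- **Eventual smallness of lattice events from null limits of closed approximants.** Fix a
Dobrushin domain and an endpoint approximation, and assume the pushed-forward hexagonal SAW laws are
tight along the mesh. Let `C m` be a decreasing sequence of closed events of `CurveClass ℂ` whose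
intersection is annihilated by every probability subsequential limit law, and `W j` lattice-side
events of curve classes with `W j ⊆ C m` for `m ≤ j`. Then for every `θ > 0` some `W j` has
`hexSAWLaw`-mass `≤ θ` for all small meshes. Proof by contradiction: otherwise pick meshes
`s j ∈ (0, 1/(j+1))` carrying probability laws with `P(curve ∈ W j) > θ`; Prokhorov along `s`
(`IsTightAlongMesh.exists_subseq` on Dirac-padded push-forwards) gives a probability limit `μ` along
a subsequence `φ`; continuity from above gives `m` with `μ (C m) < θ`; the closed-set half of the
portmanteau theorem makes `P(curve ∈ C m)` eventually `< θ` along `φ`, while for `φ n ≥ m` it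
dominates `P(curve ∈ W (φ n)) > θ`.
[cite: BillingsleyCPM1999, Thm. 5.1 (Prokhorov) and Thm. 2.1 (portmanteau, closed sets)] -/
theorem eventually_le_of_null_closedApprox {D : DobrushinDomain} {a b : ℝ → HexVertex}
    (hab : IsEmbEndpointApprox hexGraph hexCenter D a b)
    (hT : IsTightAlongMesh (fun δ (γ : HexDomainSAW D.carrier δ (a δ) (b δ)) => γ.curve)
      (fun δ => hexSAWLaw D.carrier δ (a δ) (b δ)))
    {C W : ℕ → Set (CurveClass ℂ)} (hC : ∀ m, IsClosed (C m)) (hanti : Antitone C)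
    (hWC : ∀ m j, m ≤ j → W j ⊆ C m)
    (hnull : ∀ (s : ℕ → ℝ) (μ : Measure (CurveClass ℂ)), Tendsto s atTop (𝓝[>] (0 : ℝ)) →
      IsProbabilityMeasure μ →
      (∀ f : CurveClass ℂ →ᵇ ℝ, Tendsto
        (fun n => ∫ γ, f γ.curve ∂hexSAWLaw D.carrier (s n) (a (s n)) (b (s n))) atTop
        (𝓝 (∫ x, f x ∂μ))) →
      μ (⋂ m, C m) = 0)
    {θ : ℝ} (hθ : 0 < θ) :
    ∃ j : ℕ, ∀ᶠ δ : ℝ in 𝓝[>] 0,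
      hexSAWLaw D.carrier δ (a δ) (b δ) {γ | γ.curve ∈ W j} ≤ ENNReal.ofReal θ := by
  classical
  by_contra H
  rw [not_exists] at H
  have hfreq : ∀ j : ℕ, ∃ᶠ δ in 𝓝[>] (0 : ℝ),
      ENNReal.ofReal θ < hexSAWLaw D.carrier δ (a δ) (b δ) {γ | γ.curve ∈ W j} :=
    fun j => (not_eventually.1 (H j)).mono fun δ hδ => not_le.1 hδ
  -- meshes `s j ∈ (0, 1/(j+1))` with probability laws and mass `> θ` on `W j`
  have hchoice : ∀ j : ℕ, ∃ δ : ℝ,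
      ENNReal.ofReal θ < hexSAWLaw D.carrier δ (a δ) (b δ) {γ | γ.curve ∈ W j} ∧
        IsProbabilityMeasure (hexSAWLaw D.carrier δ (a δ) (b δ)) ∧
        δ ∈ Ioo (0 : ℝ) (1 / ((j : ℝ) + 1)) := fun j =>
    ((hfreq j).and_eventually
      ((eventually_isProbabilityMeasure_hexSAWLaw hab).and
        (Ioo_mem_nhdsGT Nat.one_div_pos_of_nat))).exists
  choose s hs_bad hs_prob hs_mem using hchoice
  have hs0 : Tendsto s atTop (𝓝[>] (0 : ℝ)) := by
    refine tendsto_nhdsWithin_iff.2 ⟨?_, Eventually.of_forall fun j => (hs_mem j).1⟩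
    exact squeeze_zero (fun j => (hs_mem j).1.le) (fun j => (hs_mem j).2.le)
      tendsto_one_div_add_atTop_nhds_zero_nat
  -- the push-forward laws, padded to probability measures
  have hmeas : ∀ δ, Measurable (fun γ : HexDomainSAW D.carrier δ (a δ) (b δ) => γ.curve) :=
    fun δ => EmbDomainSAW.measurable_of_top _
  let Q : ℝ → Measure (CurveClass ℂ) := fun δ =>
    (hexSAWLaw D.carrier δ (a δ) (b δ)).map fun γ : HexDomainSAW D.carrier δ (a δ) (b δ) => γ.curve
  let c₀ : CurveClass ℂ := CurveClass.mk ⟨ContinuousMap.const _ 0⟩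
  let Q' : ℝ → Measure (CurveClass ℂ) := fun δ =>
    if IsProbabilityMeasure (Q δ) then Q δ else Measure.dirac c₀
  haveI hQ' : ∀ δ, IsProbabilityMeasure (Q' δ) := fun δ => by
    by_cases h : IsProbabilityMeasure (Q δ)
    · simp only [Q', if_pos h]; exact h
    · simp only [Q', if_neg h]; infer_instance
  have hQ'eq : ∀ δ, IsProbabilityMeasure (hexSAWLaw D.carrier δ (a δ) (b δ)) → Q' δ = Q δ := by
    intro δ hδ
    have : IsProbabilityMeasure (Q δ) := Measure.isProbabilityMeasure_map (hmeas δ).aemeasurable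
    simp only [Q', if_pos this]
  have hev : ∀ᶠ δ in 𝓝[>] (0 : ℝ), Q' δ = Q δ :=
    (eventually_isProbabilityMeasure_hexSAWLaw hab).mono hQ'eq
  have hT' : IsTightAlongMesh (fun _ => (id : CurveClass ℂ → CurveClass ℂ)) Q' := by
    intro e he
    obtain ⟨K, hK, hKev⟩ := hT e he
    refine ⟨K, hK, ?_⟩
    filter_upwards [hKev, hev] with δ h1 h2
    rw [h2, Set.preimage_id_eq, id,
      Measure.map_apply (hmeas δ) hK.isClosed.isOpen_compl.measurableSet]
    exact h1
  -- Prokhorov along the mesh sequence `s`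
  obtain ⟨φ, μ, hφ, hμ, hlim⟩ :=
    hT'.exists_subseq (Eventually.of_forall fun δ => aemeasurable_id) hs0
  have hQs : ∀ n, Q' (s (φ n)) = Q (s (φ n)) := fun n => hQ'eq _ (hs_prob (φ n))
  have hint : ∀ n (f : CurveClass ℂ →ᵇ ℝ), ∫ x, f x ∂Q' (s (φ n)) =
      ∫ ω, f ω.curve ∂hexSAWLaw D.carrier (s (φ n)) (a (s (φ n))) (b (s (φ n))) := by
    intro n f
    rw [hQs n]
    exact integral_map (hmeas _).aemeasurable f.continuous.aestronglyMeasurable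
  -- the limit annihilates `⋂ m, C m`, hence some `C m` has mass `< θ`
  haveI := hμ
  have hμ0 : μ (⋂ m, C m) = 0 :=
    hnull (s ∘ φ) μ (hs0.comp hφ.tendsto_atTop) hμ fun f => (hlim f).congr fun n => hint n f
  have htends : Tendsto (fun m => μ (C m)) atTop (𝓝 (μ (⋂ m, C m))) :=
    tendsto_measure_iInter_atTop (fun m => (hC m).measurableSet.nullMeasurableSet) hanti
      ⟨0, measure_ne_top μ _⟩
  rw [hμ0] at htends
  obtain ⟨m, hm⟩ := (htends.eventually (gt_mem_nhds (ENNReal.ofReal_pos.2 hθ))).exists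
  -- portmanteau for the closed set `C m` along the subsequence
  let ν : ℕ → ProbabilityMeasure (CurveClass ℂ) := fun n => ⟨Q' (s (φ n)), hQ' _⟩
  have hconv : Tendsto ν atTop (𝓝 (⟨μ, hμ⟩ : ProbabilityMeasure (CurveClass ℂ))) :=
    ProbabilityMeasure.tendsto_iff_forall_integral_tendsto.2 hlim
  have hlimsup := ProbabilityMeasure.limsup_measure_closed_le_of_tendsto hconv (hC m)
  have hevC : ∀ᶠ n in atTop, (ν n : Measure (CurveClass ℂ)) (C m) < ENNReal.ofReal θ :=
    eventually_lt_of_limsup_lt (hlimsup.trans_lt hm)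
  have hevm : ∀ᶠ n in atTop, m ≤ φ n :=
    (eventually_ge_atTop m).mono fun n hn => hn.trans (hφ.id_le n)
  obtain ⟨n, hnC, hnm⟩ := (hevC.and hevm).exists
  have key : ENNReal.ofReal θ < Q' (s (φ n)) (C m) :=
    calc ENNReal.ofReal θ
        < hexSAWLaw D.carrier (s (φ n)) (a (s (φ n))) (b (s (φ n))) {γ | γ.curve ∈ W (φ n)} :=
          hs_bad (φ n)
      _ ≤ hexSAWLaw D.carrier (s (φ n)) (a (s (φ n))) (b (s (φ n)))
            ((fun γ : HexDomainSAW D.carrier (s (φ n)) (a (s (φ n))) (b (s (φ n))) => γ.curve) ⁻¹'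
              C m) :=
          measure_mono fun γ hγ => hWC m (φ n) hnm hγ
      _ = Q (s (φ n)) (C m) := (Measure.map_apply (hmeas _) (hC m).measurableSet).symm
      _ = Q' (s (φ n)) (C m) := by rw [hQs n]
  exact lt_irrefl _ (key.trans hnC)

/-! ### The lattice-free core: closures of near-boundary visits touch the boundary -/

/-- The trace-phrased near-boundary-visit event agrees with the representative-phrased one of the
`δℤ²` twin (`SimpleSubseqLimits.Boundary.Core`). [folklore] -/
theorem nearFrontierVisit_eq (D : DobrushinDomain) (ρ ε : ℝ) :
    {c : CurveClass ℂ | ∃ x ∈ c.range, infDist x (frontier D.carrier) < ε ∧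
      ρ < dist x (D.pt 0) ∧ ρ < dist x (D.pt 1)} =
    {c' : CurveClass ℂ | ∃ γ : Curve ℂ, CurveClass.mk γ = c' ∧
      ∃ t : unitInterval, infDist (γ t) (frontier D.carrier) < ε ∧
        ρ < dist (γ t) (D.pt 0) ∧ ρ < dist (γ t) (D.pt 1)} := by
  ext c
  constructor
  · rintro ⟨x, hx, h⟩
    obtain ⟨γ, rfl⟩ := CurveClass.surjective_mk c
    rw [CurveClass.range_mk] at hx
    obtain ⟨t, rfl⟩ := hx
    exact ⟨γ, rfl, t, h⟩
  · rintro ⟨γ, rfl, t, h⟩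
    exact ⟨γ t, by rw [CurveClass.range_mk]; exact ⟨t, rfl⟩, h⟩

/-- **Closures of near-boundary visits touch the boundary.** For `ρ > 0`, a class lying in the
closure of the near-boundary-visit event at separation `ρ` and EVERY width `1/(n+1)` has a trace
point on `∂D` at distance `≥ ρ` from both marked points (sup-close representatives and a
convergent subsequence of witnessing times: `stub_boundaryCore` of the `δℤ²` twin, which is
lattice-free). [cite: AizenmanBurchard1999, §2.1 (curve-space topology)] -/
theorem iInter_closure_nearFrontierVisit_subset (D : DobrushinDomain) {ρ : ℝ} (hρ : 0 < ρ) :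
    (⋂ n : ℕ, closure {c : CurveClass ℂ | ∃ x ∈ c.range,
      infDist x (frontier D.carrier) < 1 / ((n : ℝ) + 1) ∧
        ρ < dist x (D.pt 0) ∧ ρ < dist x (D.pt 1)}) ⊆
    {c | ∃ x ∈ c.range, x ∈ frontier D.carrier ∧ ρ ≤ dist x (D.pt 0) ∧ ρ ≤ dist x (D.pt 1)} := by
  intro c hc
  refine stub_boundaryCore D ρ c hρ fun n => ?_
  rw [← nearFrontierVisit_eq]
  exact mem_iInter.1 hc n

/-- The exact touch event "the trace meets `∂D` at a point `ρ`-far from both marked points"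
(`ρ > 0`) is null for every law carried by classes meeting `∂D` only at the marked points.
[folklore] -/
theorem touch_null_of_ae_boundary {D : DobrushinDomain} {μ : Measure (CurveClass ℂ)} {ρ : ℝ}
    (hρ : 0 < ρ) (hae : ∀ᵐ c ∂μ, c.range ∩ frontier D.carrier ⊆ {D.pt 0, D.pt 1}) :
    μ {c | ∃ x ∈ c.range, x ∈ frontier D.carrier ∧ ρ ≤ dist x (D.pt 0) ∧
      ρ ≤ dist x (D.pt 1)} = 0 := by
  have hsub : {c : CurveClass ℂ | ∃ x ∈ c.range, x ∈ frontier D.carrier ∧ ρ ≤ dist x (D.pt 0) ∧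
      ρ ≤ dist x (D.pt 1)} ⊆ {c | ¬ (c.range ∩ frontier D.carrier ⊆ {D.pt 0, D.pt 1})} := by
    rintro c ⟨x, hxr, hxfr, h0, h1⟩ hgood
    rcases hgood ⟨hxr, hxfr⟩ with hxa | hxb
    · rw [hxa, dist_self] at h0
      exact absurd h0 (not_le.2 hρ)
    · rw [mem_singleton_iff.1 hxb, dist_self] at h1
      exact absurd h1 (not_le.2 hρ)
  exact measure_mono_null hsub (ae_iff.1 hae)

/-! ### Necessity of the no-boundary-crawling bound, given tightness -/

/-- **Given tightness, `HexSimpleSubseqLimits` implies the no-boundary-crawling bound.** If the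
pushed-forward hexagonal SAW laws are tight along the mesh for every Dobrushin domain and endpoint
approximation, then `HexSimpleSubseqLimits` yields: for all `ρ, θ > 0` there is `ε > 0` such that
for all small meshes the `hexSAWLaw`-mass of the walks whose rescaled trace comes `ε`-close to `∂D`
at a point `ρ`-far from both marked points is `≤ θ` (hypothesis (ii) of
`hexSimpleSubseqLimits_of_uniformModulus_of_boundaryDecay`). Proof:
`eventually_le_of_null_closedApprox` with `C m` the closures of the near-boundary-visit events at
widths `1/(m+1)` (their intersection is contained in the exact touch event by
`iInter_closure_nearFrontierVisit_subset`, which the item annihilates, `touch_null_of_ae_boundary`).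
[cite: BillingsleyCPM1999, Thm. 5.1 and Thm. 2.1] -/
theorem boundaryDecay_of_hexTight_of_hexSimpleSubseqLimits
    (hT : ∀ (D : DobrushinDomain) (a b : ℝ → HexVertex),
      IsEmbEndpointApprox hexGraph hexCenter D a b →
      IsTightAlongMesh (fun δ (γ : HexDomainSAW D.carrier δ (a δ) (b δ)) => γ.curve)
        (fun δ => hexSAWLaw D.carrier δ (a δ) (b δ)))
    (h : HexSimpleSubseqLimits) :
    ∀ (D : DobrushinDomain) (a b : ℝ → HexVertex), IsEmbEndpointApprox hexGraph hexCenter D a b →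
      ∀ ρ θ : ℝ, 0 < ρ → 0 < θ → ∃ ε : ℝ, 0 < ε ∧ ∀ᶠ δ : ℝ in 𝓝[>] 0,
        hexSAWLaw D.carrier δ (a δ) (b δ)
          {γ | ∃ x ∈ γ.curve.range, infDist x (frontier D.carrier) < ε ∧
            ρ < dist x (D.pt 0) ∧ ρ < dist x (D.pt 1)} ≤ ENNReal.ofReal θ := by
  intro D a b hab ρ θ hρ hθ
  -- the near-boundary-visit events at widths `1/(j+1)` and their closures
  let V : ℕ → Set (CurveClass ℂ) := fun j => {c | ∃ x ∈ c.range,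
    infDist x (frontier D.carrier) < 1 / ((j : ℝ) + 1) ∧ ρ < dist x (D.pt 0) ∧ ρ < dist x (D.pt 1)}
  have hVmono : ∀ m j, m ≤ j → V j ⊆ V m := by
    intro m j hmj c ⟨x, hx, hε, h0, h1⟩
    have hle : 1 / ((j : ℝ) + 1) ≤ 1 / ((m : ℝ) + 1) :=
      one_div_le_one_div_of_le (by positivity) (by exact_mod_cast Nat.add_le_add_right hmj 1)
    exact ⟨x, hx, hε.trans_le hle, h0, h1⟩
  have hanti : Antitone fun m => closure (V m) :=
    fun m j hmj => closure_mono (hVmono m j hmj)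
  obtain ⟨j, hj⟩ := eventually_le_of_null_closedApprox hab (hT D a b hab)
    (C := fun m => closure (V m)) (W := V) (fun m => isClosed_closure) hanti
    (fun m j hmj => (hVmono m j hmj).trans subset_closure)
    (fun s μ hs hμ hlim => by
      refine measure_mono_null (iInter_closure_nearFrontierVisit_subset D hρ) ?_
      exact touch_null_of_ae_boundary hρ
        ((h D a b hab s μ hs hμ hlim).mono fun c hc => hc.2.2.2.2))
    hθ
  exact ⟨1 / ((j : ℝ) + 1), Nat.one_div_pos_of_nat, hj⟩

/-! ### The item modulo tightness: exactly two lattice estimates -/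

/-- **`HexSimpleSubseqLimits` modulo tightness is exactly (i) ∧ (ii).** If the pushed-forward
critical hexagonal SAW laws are tight along the mesh for every Dobrushin domain and endpoint
approximation, then `HexSimpleSubseqLimits` holds iff, for every Dobrushin domain and endpoint
approximation, (i) the uniform injectivity modulus and (ii) the no-boundary-crawling bound hold
(`hexSimpleSubseqLimits_of_uniformModulus_of_boundaryDecay`,
`uniformModulus_of_hexTight_of_hexSimpleSubseqLimits`,
`boundaryDecay_of_hexTight_of_hexSimpleSubseqLimits`).
[cite: BillingsleyCPM1999, Thm. 5.1 and Thm. 2.1] -/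
theorem hexSimpleSubseqLimits_iff_of_hexTight
    (hT : ∀ (D : DobrushinDomain) (a b : ℝ → HexVertex),
      IsEmbEndpointApprox hexGraph hexCenter D a b →
      IsTightAlongMesh (fun δ (γ : HexDomainSAW D.carrier δ (a δ) (b δ)) => γ.curve)
        (fun δ => hexSAWLaw D.carrier δ (a δ) (b δ))) :
    HexSimpleSubseqLimits ↔
      (∀ (D : DobrushinDomain) (a b : ℝ → HexVertex),
        IsEmbEndpointApprox hexGraph hexCenter D a b →
        ∀ ε η : ℝ, 0 < ε → 0 < η → ∃ θ : ℝ, 0 < θ ∧ ∀ᶠ δ : ℝ in 𝓝[>] 0,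
          hexSAWLaw D.carrier δ (a δ) (b δ) {γ | γ.curve ∉ CurveClass.modulusClass ε θ} ≤
            ENNReal.ofReal η) ∧
      (∀ (D : DobrushinDomain) (a b : ℝ → HexVertex),
        IsEmbEndpointApprox hexGraph hexCenter D a b →
        ∀ ρ θ : ℝ, 0 < ρ → 0 < θ → ∃ ε : ℝ, 0 < ε ∧ ∀ᶠ δ : ℝ in 𝓝[>] 0,
          hexSAWLaw D.carrier δ (a δ) (b δ)
            {γ | ∃ x ∈ γ.curve.range, infDist x (frontier D.carrier) < ε ∧
              ρ < dist x (D.pt 0) ∧ ρ < dist x (D.pt 1)} ≤ ENNReal.ofReal θ) := by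
  constructor
  · intro h
    refine ⟨fun D a b hab ε η hε hη => ?_, boundaryDecay_of_hexTight_of_hexSimpleSubseqLimits hT h⟩
    obtain ⟨θ, hθ, hev⟩ :=
      uniformModulus_of_hexTight_of_hexSimpleSubseqLimits hT h D a b hab ε hε η hη
    exact ⟨θ, hθ, hev⟩
  · rintro ⟨hS, hB⟩
    exact hexSimpleSubseqLimits_of_uniformModulus_of_boundaryDecay hS hB

end Summit.CriticalPhenomena.SAWScalingLimit.Theorems.HexSimpleSubseqLimits

end
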